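import Literature.MathematicalPhysics.QuantumFieldTheory.Balaban1983to89.B12Spaces329NearBond
import Literature.MathematicalPhysics.QuantumFieldTheory.Balaban1983to89.B12RegularSpaces111Mono

/-!
# `Balaban1983to89.B12Spaces329Near` — T. Bałaban, *Renormalization group approach to lattice gauge field theories. I*,
Commun. Math. Phys. **109** (1987) 249–301 [Balaban1987RG1]: the clause of (3.29) p. 276 «for Gᶜ-valued transformations u in a
sufficiently small neighborhood of G-valued transformations, so that the configurations after the transformations belong to proper spaces
also», PROVED for the CONCRETE conditions (i)–(iii) of [I] §1 (`B12RegularSpaces111.SatisfiesI_III`, the second member of (3.16) and the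
space of (3.25) «defined by the same conditions … on the whole lattice»): a pair `(𝐔, 𝐉)` satisfying (i)–(iii) with constants `(α₀, α₁, γ₀)` is
carried by `v = w·exp(iξE)` (`w` `G`-valued, `|E| ≤ δ₀`, `|∇^ξ_𝐔E| ≤ δ₁`) to a pair satisfying (i)–(iii) with EXPLICIT constants
`(e^{2ξδ₀}α₀, α₁′, e^{2ξδ₀}γ₀)`, `α₁′ = (1 + 11ξ(α₁+2δ₀))(α₁ + 2δ₀ + 2ξα₀δ₀ + 2(1+4ξα₁)δ₁ + 8α₁δ₀)`

HONEST FRAMING (cell `lit-balaban`, verbatim): statement-level skeleton of published theorems with citation tags; proofs where landed; nothing here is a claim about the Yang–Mills mass gap.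

PDF held: `paper:balaban1987-cmp109-rg-i-small-field` (journal page = PDF page + 248); read from the text layer of PDF pp. 27–28 (pp. 275–276)
and pp. 14–15 (pp. 262–263); [II] = [Balaban1988RG2Cluster] p. 11 (PDF p. 11).

WHAT IS REPRODUCED.  SKELETON rows `B12.Eq3.28-3.29` (member (3.29): until now `B12RegularSpaces111Gauge.satisfiesI_III_act_iff` proved it for
`G`-valued `u` only, its docstring recording «NOT here: the sufficiently small neighborhood of G-valued transformations part of (3.29) (Gᶜ-valued u
change the constants)»; `B12Inv329` (pub-balaban) concerns a DIFFERENT issue — the block-constancy class of `u` for the functional (3.25)) and the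
last sentence of [II] Lemma 2 (row `B13.Lem2`; for the (1.34)-space itself see `B13Space134`).  This file proves the «proper spaces» half of the
clause: WHAT HAPPENS TO THE CONDITIONS (i)–(iii) under a `Gᶜ`-valued transformation near a `G`-valued one, with explicit constants.  NOT
reproduced: the invariance of the FUNCTIONS (3.25)/(3.26) (analytic continuation from `G`-valued `u`; by assertion in print), condition (iv)
(its data `U_n(M˙(·))` are carried as data; under `G`-valued `u` see `B12RegularSpaces111Gauge.condIV_gaugeU`).

THE PRINT, verbatim (p. 276): *«The functions (3.25), (3.26) are gauge invariant with respect to the simultaneous gauge transformations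
𝐔 → 𝐔^u, 𝐉 → R(u)𝐉, B → R(u)B, (3.29)  for Gᶜ-valued transformations u in a sufficiently small neighborhood of G-valued transformations, so
that the configurations after the transformations belong to proper spaces also.»*  p. 275 (the space of (3.25)): *«We will prove that it is
analytic on the space U^c_{k+1}(□₀, (1+2β)α₀, (1+2β)α₁, α₀). This space is defined by the same conditions (i)–(iv), only the configurations 𝐔, 𝐉
are defined and satisfy (i)–(iii) on the whole lattice T_η.»*  [II] p. 11: *«… gauge invariant with respect to the simultaneous gauge
transformations (I.3.29), for Gᶜ-valued transformations u in a sufficiently small neighborhood of all G-valued transformations. Let us remark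
that the last statement is a simple consequence of the statement in Sect. I.3, in the paragraph containing (I.3.29)»*.

THE STATEMENT PROVED (the print gives no mechanism; ours is recorded in `B12Spaces329NearBond`).  Model hypotheses as in
`B12RegularSpaces111Gauge` (`‖·‖ ≤ 1` on `G`, `G ≤ Gᶜ`, `𝔤ᶜ` `Ad(G)`-stable) plus the two Lie-theoretic inputs the tree does not derive in an
abstract Banach algebra (cf. `B12Membership313II`, reading note (a)): `𝔤ᶜ` is closed under the BCH composition `newPot` near `0`, and
`Ad(exp iξE)` preserves `𝔤ᶜ` for `E ∈ 𝔤ᶜ` (both trivial for `G = U(N)`, `𝔤ᶜ = M_N(ℂ)`).  The frame's region is THE WHOLE LATTICE (p. 275: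
«satisfy (i)–(iii) on the whole lattice»: every bond and every plaquette belongs to `X`).  The neighbourhood: `v = w·e`, `w` `G`-valued,
`e(x) = exp iξE(x)`, `E(x) ∈ 𝔤ᶜ`, `exp iξE(x) ∈ Gᶜ`, `|E(x)| ≤ δ₀`, `|∇^ξ_{𝐔,μ}E(x)| ≤ δ₁` (covariant derivative in the configuration `𝐔`
itself), with `ξ(α₁ + 2δ₀) ≤ 1/16`.  CONCLUSION (`satisfiesI_III_act_near`): `SatisfiesI_III (α₀, α₁, γ₀) (𝐔, 𝐉) → SatisfiesI_III (α₀′, α₁′, γ₀′)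
((𝐔, 𝐉)^v)` for any `α₀′ ≥ e^{2ξδ₀}α₀`, `γ₀′ ≥ e^{2ξδ₀}γ₀`, `α₁′ ≥ (1 + 11ξ(α₁+2δ₀))·(α₁ + 2δ₀ + 2ξα₀δ₀ + 2((1+4ξα₁)δ₁ + 4α₁δ₀))`.  As
`(δ₀, δ₁) → 0` the constants tend to `(α₀, (1+11ξα₁)α₁, γ₀)`, NOT to `(α₀, α₁, γ₀)`: the tree's BCH remainder bounds are Lipschitz bounds, not
sharp at `E = 0` (at `E = 0` itself `B12RegularSpaces111Gauge.satisfiesI_III_act` gives the same constants); in the printed use the target space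
has constants `(1+2β)α₀, (1+2β)α₁` against `(1+β)α₀, (1+β)α₁`, so the clause holds for `11ξα₁ + O(δ₀ + δ₁) ≤ β/(1+β)` — a quantitative reading
of «sufficiently small neighborhood».  Members: `factors_near` (the new factorisation `𝐔^v = (exp iξR(w)A″)·U^w`), `condIII_near` ((1.14):
factor `e^{2ξδ₀}`), `condII_near` ((1.13) for `(U^w, R(w)A″)`, covariant derivative in the `G`-valued factor), `satisfiesI_III_act_near`.  No
`Prop` placeholder, no definition, no new fact; axioms standard.  Unit `lit-balaban-p07` (Phase-2 seat p07 gen 4; TAKING line HOME/STATUS.md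
2026-08-21T04:15:06Z), HOME `run/shared/lean/pub/lit-balaban/`.
-/

namespace Literature.MathematicalPhysics.QuantumFieldTheory.Balaban1983to89.B12Spaces329Near

open NormedSpace
open Literature.MathematicalPhysics.QuantumFieldTheory.Balaban1983to89
open Literature.MathematicalPhysics.QuantumFieldTheory.Balaban1983to89.B12RegularSpaces111
open Literature.MathematicalPhysics.QuantumFieldTheory.Balaban1983to89.B12RegularSpaces111Gauge
open Literature.MathematicalPhysics.QuantumFieldTheory.Balaban1983to89.B12RegularSpaces111Mono
open Literature.MathematicalPhysics.QuantumFieldTheory.Balaban1983to89.B12Membership314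
open Literature.MathematicalPhysics.QuantumFieldTheory.Balaban1983to89.B12Membership313II
open Literature.MathematicalPhysics.QuantumFieldTheory.Balaban1983to89.B12Spaces329NearBond
open Complex (I)

noncomputable section

variable {P : Params} {i : ℕ} {𝔸 : Type*} [NormedRing 𝔸] [NormedAlgebra ℂ 𝔸] [CompleteSpace 𝔸]
variable {𝓜 : Model 𝔸}

/-- Lattice translations commute. [folklore] -/
private theorem shift_shift_comm (x : Site P i) (μ ν : Fin P.d) : (x.shift μ).shift ν = (x.shift ν).shift μ := by
  funext κ
  by_cases h1 : κ = ν
  · subst h1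
    by_cases h2 : κ = μ
    · subst h2; rfl
    · simp [Site.shift, Function.update_apply, h2]
  · by_cases h2 : κ = μ
    · subst h2; simp [Site.shift, Function.update_apply, h1]
    · simp [Site.shift, Function.update_apply, h1, h2]

/-! ## §1. The new factorisation: `𝐔^v = (exp iξR(w)A″)·U^w` -/

/-- **The transformed configuration factorises again** as «(exp iξA‴)·(G-valued)» (condition (i)'s `𝐔 = U′U`, `U′ = exp iξA′`): for
`𝐔 = (exp iξA′)U` with `U` `G`-valued and `|A′| ≤ α₁` everywhere, and `v = w·exp(iξE)` with `|E| ≤ δ`, `ξ(α₁ + 2δ) ≤ 1/16`,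
`𝐔^v = (exp iξR(w)A″)·U^w`, `A″(b) = newPot ξ E(b₋) (newPot ξ A′(b) (−R(U(b))E(b₊)))` (`B12Spaces329NearBond.gaugeU_factor_near`).
[cite: Balaban1987RG1, (3.29) p.276] -/
theorem factors_near {G : Subgroup 𝔸ˣ} (hG1 : ∀ g ∈ G, ‖(g : 𝔸)‖ ≤ 1) {c : StepConsts} (hξ : 0 < c.ξ) {α₁ δ : ℝ} (hα₁ : 0 ≤ α₁)
    (hδ : 0 ≤ δ) (hs : c.ξ * (α₁ + 2 * δ) ≤ 1 / 16) {Uc U : PBond P i → 𝔸ˣ} {A' : PBond P i → 𝔸} (hf : Factors c Uc U A')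
    (hU : ∀ b, U b ∈ G) (hA : ∀ b, ‖A' b‖ ≤ α₁) (w : Site P i → 𝔸ˣ) {E : Site P i → 𝔸} (hE : ∀ x, ‖E x‖ ≤ δ) :
    Factors c (gaugeU (w * fun x => expI c.ξ (E x)) Uc) (gaugeU w U)
      (adJ w fun b => newPot c.ξ (E b.src) (newPot c.ξ (A' b) ((U b : 𝔸) * (-E b.tgt) * ↑(U b)⁻¹))) := by
  intro b
  obtain ⟨h1, -, -⟩ := norm_newPot2_le hG1 hξ hα₁ hδ hs (hU b) (hE b.tgt) (hA b)
  obtain ⟨h2, -⟩ := norm_newPot3_le hG1 hξ hα₁ hδ hs (hU b) (hE b.src) (hE b.tgt) (hA b)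
  exact gaugeU_factor_near hξ w E b (hf b) (h1.trans (by norm_num)) (h2.trans (by norm_num))

/-! ## §2. Condition (iii), (1.14): plaquette variables and currents move by `e^{2ξδ₀}` -/

omit [NormedAlgebra ℂ 𝔸] [CompleteSpace 𝔸] in
/-- `exp` is monotone: `e^{2ξ|E(x)|} ≤ e^{2ξδ}` for `|E(x)| ≤ δ`, `ξ ≥ 0`. [folklore] -/
private theorem exp_le_exp_of_norm_le {ξ δ : ℝ} (hξ : 0 ≤ ξ) {E₀ : 𝔸} (hE : ‖E₀‖ ≤ δ) :
    Real.exp (2 * (ξ * ‖E₀‖)) ≤ Real.exp (2 * (ξ * δ)) :=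
  Real.exp_le_exp.mpr (by nlinarith)

/-- **(iii) under `v = w·exp(iξE)`**: if `(𝐔, 𝐉)` satisfy (1.14) with `(α₀, γ₀)` (`α₀ ≥ 0`), `w` is `G`-valued (`‖·‖ ≤ 1` on `G`) and `|E| ≤ δ`,
then `(𝐔^v, R(v)𝐉)` satisfy (1.14) with any `α₀′ ≥ e^{2ξδ}α₀`, `γ₀′ ≥ e^{2ξδ}γ₀`: `∂(𝐔^v)(p) = w(x)e(x)·∂𝐔(p)·e(x)⁻¹w(x)⁻¹` and conjugation by
`e(x) = exp iξE(x)` costs at most `e^{2ξ|E(x)|}` (`B12Spaces329NearBond.norm_conj_expI_sub_one_le`, `norm_conj_expI_le`).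
[cite: Balaban1987RG1, (3.29) p.276] -/
theorem condIII_near {G : Subgroup 𝔸ˣ} (hG1 : ∀ g ∈ G, ‖(g : 𝔸)‖ ≤ 1) {X : Region P i} {c : StepConsts} (hξ : 0 ≤ c.ξ)
    {α₀ γ₀ δ α₀' γ₀' : ℝ} (hα₀ : 0 ≤ α₀) (hα₀' : Real.exp (2 * (c.ξ * δ)) * α₀ ≤ α₀')
    (hγ₀' : Real.exp (2 * (c.ξ * δ)) * γ₀ ≤ γ₀') {Uc : PBond P i → 𝔸ˣ} {Jc : PBond P i → 𝔸} {w : Site P i → 𝔸ˣ}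
    (hw : ∀ x, w x ∈ G) {E : Site P i → 𝔸} (hE : ∀ x, ‖E x‖ ≤ δ) (h : CondIII X c α₀ γ₀ Uc Jc) :
    CondIII X c α₀' γ₀' (gaugeU (w * fun x => expI c.ξ (E x)) Uc) (adJ (w * fun x => expI c.ξ (E x)) Jc) := by
  refine ⟨fun p hp => ?_, fun b hb => ?_⟩
  · rw [gaugeU_mul, plaq_gaugeU, plaq_gaugeU, Units.val_mul, Units.val_mul, norm_conj_sub_one_eq hG1 (hw p.src),
      Units.val_mul, Units.val_mul]
    have hlt := h.plaq_lt p hp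
    calc ‖(expI c.ξ (E p.src) : 𝔸) * ↑(plaq Uc p) * ↑(expI c.ξ (E p.src))⁻¹ - 1‖
        ≤ Real.exp (2 * (c.ξ * ‖E p.src‖)) * ‖(↑(plaq Uc p) : 𝔸) - 1‖ := norm_conj_expI_sub_one_le hξ _ _
      _ < Real.exp (2 * (c.ξ * ‖E p.src‖)) * (α₀ * c.ξ ^ 2) := mul_lt_mul_of_pos_left hlt (Real.exp_pos _)
      _ ≤ Real.exp (2 * (c.ξ * δ)) * (α₀ * c.ξ ^ 2) :=
          mul_le_mul_of_nonneg_right (exp_le_exp_of_norm_le hξ (hE p.src)) (by positivity)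
      _ ≤ α₀' * c.ξ ^ 2 := by rw [← mul_assoc]; exact mul_le_mul_of_nonneg_right hα₀' (sq_nonneg _)
  · rw [adJ_mul]
    show ‖(w b.src : 𝔸) * adJ (fun x => expI c.ξ (E x)) Jc b * ↑(w b.src)⁻¹‖ < γ₀'
    rw [norm_conj_eq hG1 (hw b.src)]
    have hlt := h.J_lt b hb
    have hγ₀ : 0 < γ₀ := (norm_nonneg _).trans_lt hlt
    calc ‖adJ (fun x => expI c.ξ (E x)) Jc b‖ = ‖(expI c.ξ (E b.src) : 𝔸) * Jc b * ↑(expI c.ξ (E b.src))⁻¹‖ := rfl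
      _ ≤ Real.exp (2 * (c.ξ * ‖E b.src‖)) * ‖Jc b‖ := norm_conj_expI_le hξ _ _
      _ < Real.exp (2 * (c.ξ * ‖E b.src‖)) * γ₀ := mul_lt_mul_of_pos_left hlt (Real.exp_pos _)
      _ ≤ Real.exp (2 * (c.ξ * δ)) * γ₀ := mul_le_mul_of_nonneg_right (exp_le_exp_of_norm_le hξ (hE b.src)) hγ₀.le
      _ ≤ γ₀' := hγ₀'

/-! ## §3. Condition (ii), (1.13), for the new potential `A‴ = R(w)A″` in the background `U^w` -/

/-- Real arithmetic: the budget of (ii).  With `s = α₁ + 2δ₀ ≥ 0`, `ξs ≤ 1/16`, nonnegative letters, and the two Lipschitz constants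
`C₀ = 1 + 3ξ((19/16)s)`, `C₁ = 1 + 3ξ(α₁ + δ₀)`:  `C₀(δ₁ + C₁(α₁ + 2ξα₀δ₀ + δ₁)) ≤ (1 + 11ξs)(α₁ + 2δ₀ + 2ξα₀δ₀ + 2δ₁)` and
`α₁ + 2δ₀ + 8ξs² ≤ (1 + 11ξs)(α₁ + 2δ₀ + 2ξα₀δ₀ + 2δ₁)`. [folklore] -/
private theorem budgetII {ξ α₀ α₁ δ₀ δ₁ : ℝ} (hξ : 0 ≤ ξ) (hα₀ : 0 ≤ α₀) (hα₁ : 0 ≤ α₁) (hδ₀ : 0 ≤ δ₀) (hδ₁ : 0 ≤ δ₁)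
    (hs : ξ * (α₁ + 2 * δ₀) ≤ 1 / 16) :
    (1 + 3 * (ξ * ((19 / 16) * (α₁ + 2 * δ₀)))) *
        (δ₁ + (1 + 3 * (ξ * α₁ + ξ * δ₀)) * (α₁ + 2 * ξ * α₀ * δ₀ + δ₁)) ≤
      (1 + 11 * ξ * (α₁ + 2 * δ₀)) * (α₁ + 2 * δ₀ + 2 * ξ * α₀ * δ₀ + 2 * δ₁) ∧
    α₁ + 2 * δ₀ + 8 * ξ * (α₁ + 2 * δ₀) ^ 2 ≤ (1 + 11 * ξ * (α₁ + 2 * δ₀)) * (α₁ + 2 * δ₀ + 2 * ξ * α₀ * δ₀ + 2 * δ₁) := by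
  set s := α₁ + 2 * δ₀ with hsdef
  have hs0 : 0 ≤ s := by positivity
  have hξs : 0 ≤ ξ * s := mul_nonneg hξ hs0
  have hR : 0 ≤ α₁ + 2 * ξ * α₀ * δ₀ + δ₁ := by positivity
  constructor
  · -- `C₁ ≤ 1 + 3ξs`, `C₀ ≤ 1 + (57/16)ξs`, `C₀C₁ ≤ 1 + 11ξs`
    have hC₁ : 1 + 3 * (ξ * α₁ + ξ * δ₀) ≤ 1 + 3 * (ξ * s) := by nlinarith
    have hC₀ : 1 + 3 * (ξ * ((19 / 16) * (α₁ + 2 * δ₀))) ≤ 1 + 4 * (ξ * s) := by nlinarith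
    have hprod : (1 + 4 * (ξ * s)) * (1 + 3 * (ξ * s)) ≤ 1 + 11 * (ξ * s) := by nlinarith
    calc (1 + 3 * (ξ * ((19 / 16) * (α₁ + 2 * δ₀)))) * (δ₁ + (1 + 3 * (ξ * α₁ + ξ * δ₀)) * (α₁ + 2 * ξ * α₀ * δ₀ + δ₁))
        ≤ (1 + 4 * (ξ * s)) * (δ₁ + (1 + 3 * (ξ * s)) * (α₁ + 2 * ξ * α₀ * δ₀ + δ₁)) := by
          gcongr
      _ = (1 + 4 * (ξ * s)) * δ₁ + (1 + 4 * (ξ * s)) * (1 + 3 * (ξ * s)) * (α₁ + 2 * ξ * α₀ * δ₀ + δ₁) := by ring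
      _ ≤ (1 + 11 * (ξ * s)) * δ₁ + (1 + 11 * (ξ * s)) * (α₁ + 2 * ξ * α₀ * δ₀ + δ₁) := by
          gcongr ?_ * δ₁ + ?_
          · linarith
          · exact mul_le_mul_of_nonneg_right hprod hR
      _ ≤ (1 + 11 * ξ * (α₁ + 2 * δ₀)) * (α₁ + 2 * δ₀ + 2 * ξ * α₀ * δ₀ + 2 * δ₁) := by
          rw [← hsdef]
          have h2 : 0 ≤ 2 * ξ * α₀ * δ₀ := by positivity
          nlinarith [mul_nonneg hξs hδ₀, mul_nonneg hξs h2, mul_nonneg hξs hδ₁]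
  · have h2 : 0 ≤ 2 * ξ * α₀ * δ₀ + 2 * δ₁ := by positivity
    have h3 : 8 * ξ * s ^ 2 ≤ 11 * ξ * s * s := by nlinarith [mul_nonneg hξs hs0]
    nlinarith [mul_nonneg hξs h2, mul_nonneg hξs hs0]

/-- **(ii) for the new pair `(U^w, R(w)A″)`.**  Frame region = the whole lattice (every bond, every plaquette in `X`, p. 275).  If `U` satisfies
(i) with `α₀` and `(U, A′)` satisfy (ii) with `α₁`, `w` is `G`-valued, `E` is `𝔤ᶜ`-valued with `|E| ≤ δ₀` and `|∇^ξ_{U,μ}E| ≤ δ₁` (covariant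
derivative in the `G`-valued factor), and `ξ(α₁ + 2δ₀) ≤ 1/16`, then `(U^w, R(w)A″)` satisfy (ii) with any
`α₁′ ≥ (1 + 11ξ(α₁+2δ₀))(α₁ + 2δ₀ + 2ξα₀δ₀ + 2δ₁)`.  Mechanism (`B12Spaces329NearBond`): `|A″(b)| ≤ |A′(b)| + 2δ₀ + 8ξ(α₁+2δ₀)²`; the
covariant derivative of `A″` is that of its three constituents up to the BCH Lipschitz constants (`B12Membership313II.norm_covD_newPot_le`,
twice), and the transported constituent `−R(U(b))E(b₊)` has covariant derivative `≤ 2ξα₀δ₀ + δ₁` by a conjugated plaquette of `U`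
(`norm_covD_transport_le`, `norm_loop_sub_one_eq`); `R(w)`, `w ∈ G`, is an isometry commuting with `∇^ξ` (`B12RegularSpaces111Gauge.nabla_gaugeU_adJ`).
Model inputs: `Ad(G)`-stability of `𝔤ᶜ` and closure of `𝔤ᶜ` under `newPot` near `0`. [cite: Balaban1987RG1, (3.29) p.276] -/
theorem condII_near (hG1 : ∀ g ∈ 𝓜.G, ‖(g : 𝔸)‖ ≤ 1) (hgc : ∀ g ∈ 𝓜.G, ∀ X ∈ 𝓜.gc, (g : 𝔸) * X * ↑g⁻¹ ∈ 𝓜.gc)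
    (hgcN : ∀ (ξ : ℝ) (X : 𝔸), X ∈ 𝓜.gc → ∀ Y ∈ 𝓜.gc, ξ * (‖X‖ + ‖Y‖) ≤ 1 / 4 → newPot ξ X Y ∈ 𝓜.gc)
    {F : Frame P i 𝔸} (hXb : ∀ b, b ∈ F.X.bonds) (hXp : ∀ p, p ∈ F.X.plaqs) {c : StepConsts} (hξ : 0 < c.ξ)
    {α₀ α₁ δ₀ δ₁ α₁' : ℝ} (hα₀ : 0 ≤ α₀) (hα₁ : 0 ≤ α₁) (hδ₀ : 0 ≤ δ₀) (hδ₁ : 0 ≤ δ₁) (hs : c.ξ * (α₁ + 2 * δ₀) ≤ 1 / 16)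
    (hα₁' : (1 + 11 * c.ξ * (α₁ + 2 * δ₀)) * (α₁ + 2 * δ₀ + 2 * c.ξ * α₀ * δ₀ + 2 * δ₁) ≤ α₁')
    {U : PBond P i → 𝔸ˣ} {A' : PBond P i → 𝔸} (hI : CondI 𝓜 F c α₀ U) (hII : CondII 𝓜 F.X c α₁ U A')
    {w : Site P i → 𝔸ˣ} (hw : ∀ x, w x ∈ 𝓜.G) {E : Site P i → 𝔸} (hEgc : ∀ x, E x ∈ 𝓜.gc) (hE0 : ∀ x, ‖E x‖ ≤ δ₀)
    (hE1 : ∀ x μ, ‖nabla c.ξ U μ E x‖ ≤ δ₁) :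
    CondII 𝓜 F.X c α₁' (gaugeU w U)
      (adJ w fun b => newPot c.ξ (E b.src) (newPot c.ξ (A' b) ((U b : 𝔸) * (-E b.tgt) * ↑(U b)⁻¹))) := by
  -- standing facts
  have hUG : ∀ b, U b ∈ 𝓜.G := fun b => hI.gValued b (hXb b)
  have hA : ∀ b, ‖A' b‖ ≤ α₁ := fun b => (hII.norm_lt b (hXb b)).le
  have hplaq : ∀ p, ‖(↑(plaq U p) : 𝔸) - 1‖ ≤ α₀ * c.ξ ^ 2 := fun p => (hI.plaq_lt p (hXp p)).le
  have hTn : ∀ (b : PBond P i) (y : Site P i), ‖(U b : 𝔸) * (-E y) * ↑(U b)⁻¹‖ ≤ δ₀ := fun b y => by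
    rw [norm_conj_eq hG1 (hUG b), norm_neg]; exact hE0 y
  obtain ⟨hbud, hbud'⟩ := budgetII hξ.le hα₀ hα₁ hδ₀ hδ₁ hs
  set s := α₁ + 2 * δ₀ with hsdef
  -- abbreviations: `T b = −R(U(b))E(b₊)`, `N b = newPot ξ A′(b) (T b)`, `A″ b = newPot ξ E(b₋) (N b)`
  set T : PBond P i → 𝔸 := fun b => (U b : 𝔸) * (-E b.tgt) * ↑(U b)⁻¹ with hTdef
  set N : PBond P i → 𝔸 := fun b => newPot c.ξ (A' b) (T b) with hNdef
  have h2b : ∀ b, c.ξ * (‖A' b‖ + ‖T b‖) ≤ 1 / 16 ∧ ‖N b‖ ≤ ‖A' b‖ + δ₀ + 3 * c.ξ * s ^ 2 ∧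
      ‖N b‖ + δ₀ ≤ (19 / 16) * s := fun b => norm_newPot2_le hG1 hξ hα₁ hδ₀ hs (hUG b) (hE0 b.tgt) (hA b)
  have h3b : ∀ b, c.ξ * (‖E b.src‖ + ‖N b‖) ≤ 1 / 8 ∧ ‖newPot c.ξ (E b.src) (N b)‖ ≤ ‖A' b‖ + 2 * δ₀ + 8 * c.ξ * s ^ 2 :=
    fun b => norm_newPot3_le hG1 hξ hα₁ hδ₀ hs (hUG b) (hE0 b.src) (hE0 b.tgt) (hA b)
  refine ⟨fun b _ => ?_, fun b _ => ?_, fun q hq => ?_⟩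
  · -- «A‴ has values in the algebra 𝔤ᶜ»
    show (w b.src : 𝔸) * newPot c.ξ (E b.src) (N b) * ↑(w b.src)⁻¹ ∈ 𝓜.gc
    refine hgc _ (hw _) _ (hgcN _ _ (hEgc _) _ (hgcN _ _ (hII.gcValued b (hXb b)) _ ?_ ((h2b b).1.trans (by norm_num)))
      ((h3b b).1.trans (by norm_num)))
    exact hgc _ (hUG b) _ (𝓜.gc.neg_mem (hEgc _))
  · -- `|A‴| < α₁′`
    show ‖(w b.src : 𝔸) * newPot c.ξ (E b.src) (N b) * ↑(w b.src)⁻¹‖ < α₁'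
    rw [norm_conj_eq hG1 (hw _)]
    have hlt : ‖A' b‖ < α₁ := hII.norm_lt b (hXb b)
    calc ‖newPot c.ξ (E b.src) (N b)‖ ≤ ‖A' b‖ + 2 * δ₀ + 8 * c.ξ * s ^ 2 := (h3b b).2
      _ < α₁ + 2 * δ₀ + 8 * c.ξ * s ^ 2 := by linarith
      _ ≤ α₁' := by rw [hsdef] at hbud' ⊢; exact hbud'.trans hα₁'
  · -- `|∇^ξ_{U^w}A‴| < α₁′`
    obtain ⟨x, μ, ν⟩ := q
    dsimp only
    rw [nabla_gaugeU_adJ, norm_conj_eq hG1 (hw _)]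
    -- the three constituents along the `ν`-bonds
    have hcomm : (x.shift μ).shift ν = (x.shift ν).shift μ := shift_shift_comm x μ ν
    -- (a) the transported field: `‖∇_μ T_ν(x)‖ ≤ 2ξα₀δ₀ + δ₁`
    have hW : ‖(((U ⟨x, ν⟩)⁻¹ * U ⟨x, μ⟩ * U ⟨x.shift μ, ν⟩ * (U ⟨x.shift ν, μ⟩)⁻¹ : 𝔸ˣ) : 𝔸) - 1‖ ≤ α₀ * c.ξ ^ 2 := by
      rcases lt_trichotomy μ ν with hμν | rfl | hνμ
      · rw [norm_loop_sub_one_eq hG1 (hUG ⟨x, ν⟩), ← plaq_eq U ⟨x, μ, ν, hμν⟩]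
        exact hplaq _
      · rw [loop_eq_one_of_eq, Units.val_one, sub_self, norm_zero]; positivity
      · refine (norm_loop_sub_one_le_of_gt hG1 (hUG _) (hUG _) (hUG _) (hUG _)).trans ?_
        rw [← plaq_eq U ⟨x, ν, μ, hνμ⟩]
        exact hplaq _
    have hT : ‖(c.ξ : ℂ)⁻¹ • ((U ⟨x, μ⟩ : 𝔸) * T ⟨x.shift μ, ν⟩ * ↑(U ⟨x, μ⟩)⁻¹ - T ⟨x, ν⟩)‖ ≤
        2 * c.ξ * α₀ * δ₀ + δ₁ := by
      have h := norm_covD_transport_le hG1 hξ (hUG ⟨x, μ⟩) (hUG ⟨x, ν⟩) (hUG ⟨x.shift μ, ν⟩) (hUG ⟨x.shift ν, μ⟩)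
        (E (x.shift ν)) (E ((x.shift μ).shift ν))
      have hn : (c.ξ : ℂ)⁻¹ • ((U ⟨x.shift ν, μ⟩ : 𝔸) * E ((x.shift μ).shift ν) * ↑(U ⟨x.shift ν, μ⟩)⁻¹ - E (x.shift ν)) =
          nabla c.ξ U μ E (x.shift ν) := by rw [hcomm]; rfl
      rw [hn] at h
      refine h.trans ?_
      have h1 : 2 * c.ξ⁻¹ * ‖(((U ⟨x, ν⟩)⁻¹ * U ⟨x, μ⟩ * U ⟨x.shift μ, ν⟩ * (U ⟨x.shift ν, μ⟩)⁻¹ : 𝔸ˣ) : 𝔸) - 1‖ *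
          ‖E ((x.shift μ).shift ν)‖ ≤ 2 * c.ξ⁻¹ * (α₀ * c.ξ ^ 2) * δ₀ := by
        gcongr
        exact hE0 _
      have h2 : 2 * c.ξ⁻¹ * (α₀ * c.ξ ^ 2) * δ₀ = 2 * c.ξ * α₀ * δ₀ := by
        field_simp
      linarith [hE1 (x.shift ν) μ]
    -- (b) the inner composition: `‖∇_μ N_ν(x)‖ ≤ C₁(|∇_μ A′_ν(x)| + 2ξα₀δ₀ + δ₁)`
    have hN : ‖(c.ξ : ℂ)⁻¹ • ((U ⟨x, μ⟩ : 𝔸) * N ⟨x.shift μ, ν⟩ * ↑(U ⟨x, μ⟩)⁻¹ - N ⟨x, ν⟩)‖ ≤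
        (1 + 3 * (c.ξ * α₁ + c.ξ * δ₀)) *
          (‖nabla c.ξ U μ (fun y => A' ⟨y, ν⟩) x‖ + (2 * c.ξ * α₀ * δ₀ + δ₁)) := by
      have hw' := norm_expI_prod_sub_one_lt_one hξ.le (((h2b ⟨x.shift μ, ν⟩).1).trans (by norm_num))
      have hA1 : c.ξ * ‖A' ⟨x, ν⟩‖ ≤ c.ξ * α₁ := mul_le_mul_of_nonneg_left (hA ⟨x, ν⟩) hξ.le
      have hA2 : c.ξ * ‖(U ⟨x, μ⟩ : 𝔸) * A' ⟨x.shift μ, ν⟩ * ↑(U ⟨x, μ⟩)⁻¹‖ ≤ c.ξ * α₁ := by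
        rw [norm_conj_eq hG1 (hUG _)]; exact mul_le_mul_of_nonneg_left (hA ⟨x.shift μ, ν⟩) hξ.le
      have hT1 : c.ξ * ‖T ⟨x, ν⟩‖ ≤ c.ξ * δ₀ := mul_le_mul_of_nonneg_left (hTn ⟨x, ν⟩ (x.shift ν)) hξ.le
      have hT2 : c.ξ * ‖(U ⟨x, μ⟩ : 𝔸) * T ⟨x.shift μ, ν⟩ * ↑(U ⟨x, μ⟩)⁻¹‖ ≤ c.ξ * δ₀ := by
        rw [norm_conj_eq hG1 (hUG _)]; exact mul_le_mul_of_nonneg_left (hTn ⟨x.shift μ, ν⟩ ((x.shift μ).shift ν)) hξ.le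
      have hr : c.ξ * α₁ + c.ξ * δ₀ ≤ 1 / 8 := by nlinarith
      have h := norm_covD_newPot_le (A := A' ⟨x, ν⟩) (A₁ := A' ⟨x.shift μ, ν⟩) (A' := T ⟨x, ν⟩)
        (A'₁ := T ⟨x.shift μ, ν⟩) (U ⟨x, μ⟩) hξ hw' hA1 hA2 hT1 hT2 hr
      exact h.trans (mul_le_mul_of_nonneg_left (add_le_add le_rfl hT) (by positivity))
    -- (c) the outer composition: `‖∇_μ A″_ν(x)‖ ≤ C₀(|∇_μ E(x)| + ‖∇_μ N_ν(x)‖)`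
    have hm : ∀ b, c.ξ * ‖N b‖ ≤ c.ξ * ((19 / 16) * s - δ₀) := fun b =>
      mul_le_mul_of_nonneg_left (by linarith [(h2b b).2.2]) hξ.le
    have hA'' : ‖(c.ξ : ℂ)⁻¹ • ((U ⟨x, μ⟩ : 𝔸) * newPot c.ξ (E (x.shift μ)) (N ⟨x.shift μ, ν⟩) * ↑(U ⟨x, μ⟩)⁻¹ -
          newPot c.ξ (E x) (N ⟨x, ν⟩))‖ ≤
        (1 + 3 * (c.ξ * δ₀ + c.ξ * ((19 / 16) * s - δ₀))) *
          (‖nabla c.ξ U μ E x‖ + ‖(c.ξ : ℂ)⁻¹ • ((U ⟨x, μ⟩ : 𝔸) * N ⟨x.shift μ, ν⟩ * ↑(U ⟨x, μ⟩)⁻¹ - N ⟨x, ν⟩)‖) := by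
      have hw' := norm_expI_prod_sub_one_lt_one hξ.le (((h3b ⟨x.shift μ, ν⟩).1).trans (by norm_num))
      have hE2 : c.ξ * ‖(U ⟨x, μ⟩ : 𝔸) * E (x.shift μ) * ↑(U ⟨x, μ⟩)⁻¹‖ ≤ c.ξ * δ₀ := by
        rw [norm_conj_eq hG1 (hUG _)]; exact mul_le_mul_of_nonneg_left (hE0 _) hξ.le
      have hN2 : c.ξ * ‖(U ⟨x, μ⟩ : 𝔸) * N ⟨x.shift μ, ν⟩ * ↑(U ⟨x, μ⟩)⁻¹‖ ≤ c.ξ * ((19 / 16) * s - δ₀) := by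
        rw [norm_conj_eq hG1 (hUG _)]; exact hm ⟨x.shift μ, ν⟩
      have hr : c.ξ * δ₀ + c.ξ * ((19 / 16) * s - δ₀) ≤ 1 / 8 := by nlinarith
      exact norm_covD_newPot_le (A := E x) (A₁ := E (x.shift μ)) (A' := N ⟨x, ν⟩) (A'₁ := N ⟨x.shift μ, ν⟩)
        (U ⟨x, μ⟩) hξ hw' (mul_le_mul_of_nonneg_left (hE0 x) hξ.le) hE2 (hm ⟨x, ν⟩) hN2 hr
    -- (d) assembly of the bound: strict in `|∇_μ A′_ν(x)| < α₁`
    have hlt : ‖nabla c.ξ U μ (fun y => A' ⟨y, ν⟩) x‖ < α₁ := hII.nabla_lt (x, μ, ν) hq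
    have hC₀ : 0 < 1 + 3 * (c.ξ * δ₀ + c.ξ * ((19 / 16) * s - δ₀)) := by
      have : 0 ≤ c.ξ * ((19 / 16) * s - δ₀) := le_trans (by positivity) (hm ⟨x, ν⟩); positivity
    have hC₁ : 0 < 1 + 3 * (c.ξ * α₁ + c.ξ * δ₀) := by positivity
    have e0 : 1 + 3 * (c.ξ * δ₀ + c.ξ * ((19 / 16) * s - δ₀)) = 1 + 3 * (c.ξ * ((19 / 16) * (α₁ + 2 * δ₀))) := by
      rw [hsdef]; ring
    calc ‖nabla c.ξ U μ (fun y => newPot c.ξ (E (⟨y, ν⟩ : PBond P i).src) (N ⟨y, ν⟩)) x‖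
        = ‖(c.ξ : ℂ)⁻¹ • ((U ⟨x, μ⟩ : 𝔸) * newPot c.ξ (E (x.shift μ)) (N ⟨x.shift μ, ν⟩) * ↑(U ⟨x, μ⟩)⁻¹ -
            newPot c.ξ (E x) (N ⟨x, ν⟩))‖ := rfl
      _ ≤ (1 + 3 * (c.ξ * δ₀ + c.ξ * ((19 / 16) * s - δ₀))) *
            (δ₁ + (1 + 3 * (c.ξ * α₁ + c.ξ * δ₀)) *
              (‖nabla c.ξ U μ (fun y => A' ⟨y, ν⟩) x‖ + (2 * c.ξ * α₀ * δ₀ + δ₁))) :=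
          hA''.trans (mul_le_mul_of_nonneg_left (add_le_add (hE1 x μ) hN) hC₀.le)
      _ < (1 + 3 * (c.ξ * δ₀ + c.ξ * ((19 / 16) * s - δ₀))) *
            (δ₁ + (1 + 3 * (c.ξ * α₁ + c.ξ * δ₀)) * (α₁ + (2 * c.ξ * α₀ * δ₀ + δ₁))) := by
          gcongr
      _ = (1 + 3 * (c.ξ * ((19 / 16) * (α₁ + 2 * δ₀)))) *
            (δ₁ + (1 + 3 * (c.ξ * α₁ + c.ξ * δ₀)) * (α₁ + 2 * c.ξ * α₀ * δ₀ + δ₁)) := by rw [e0, add_assoc]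
      _ ≤ (1 + 11 * c.ξ * (α₁ + 2 * δ₀)) * (α₁ + 2 * δ₀ + 2 * c.ξ * α₀ * δ₀ + 2 * δ₁) := by
          rw [hsdef] at hbud; exact hbud
      _ ≤ α₁' := hα₁'

/-! ## §4. Assembly: (i)–(iii) under `Gᶜ`-valued gauge transformations near the `G`-valued ones -/

/-- **The «proper spaces» clause of (3.29) for the conditions (i)–(iii).**  Frame region = the whole lattice («satisfy (i)–(iii) on the whole
lattice», p. 275).  Let `(𝐔, 𝐉)` satisfy (i)–(iii) with constants `(α₀, α₁, γ₀)` (`α₀, α₁ ≥ 0`), and let `v = w·e` with `w` `G`-valued,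
`e(x) = exp iξE(x) ∈ Gᶜ`, `E(x) ∈ 𝔤ᶜ`, `|E(x)| ≤ δ₀`, `|∇^ξ_{𝐔,μ}E(x)| ≤ δ₁` (covariant derivative in `𝐔` itself), `ξ(α₁ + 2δ₀) ≤ 1/16`.  Then
`(𝐔, 𝐉)^v = (𝐔^v, R(v)𝐉)` satisfies (i)–(iii) with any constants `α₀′ ≥ e^{2ξδ₀}α₀`, `γ₀′ ≥ e^{2ξδ₀}γ₀`,
`α₁′ ≥ (1 + 11ξ(α₁+2δ₀))·(α₁ + 2δ₀ + 2ξα₀δ₀ + 2((1+4ξα₁)δ₁ + 4α₁δ₀))` — «so that the configurations after the transformations belong to proper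
spaces also».  The new factorisation is `𝐔^v = (exp iξR(w)A″)·U^w` (`factors_near`); (i) for `U^w` by `B12RegularSpaces111Gauge.condI_gaugeU`
(same `α₀`) and monotonicity; (ii) by `condII_near` after converting `∇^ξ_𝐔E` into `∇^ξ_UE` (`B12Spaces329NearBond.norm_nabla_factor_le`);
(iii) by `condIII_near`.  Model hypotheses: `‖·‖ ≤ 1` on `G`, `G ≤ Gᶜ`, `𝔤ᶜ` `Ad(G)`-stable, `Ad(e(x))`-stable and closed under `newPot`
near `0`; `O(1)LMB ≥ 0`. [cite: Balaban1987RG1, (3.29) p.276] -/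
theorem satisfiesI_III_act_near (hG1 : ∀ g ∈ 𝓜.G, ‖(g : 𝔸)‖ ≤ 1) (hGc : 𝓜.G ≤ 𝓜.Gc)
    (hgc : ∀ g ∈ 𝓜.G, ∀ X ∈ 𝓜.gc, (g : 𝔸) * X * ↑g⁻¹ ∈ 𝓜.gc)
    (hgcN : ∀ (ξ : ℝ) (X : 𝔸), X ∈ 𝓜.gc → ∀ Y ∈ 𝓜.gc, ξ * (‖X‖ + ‖Y‖) ≤ 1 / 4 → newPot ξ X Y ∈ 𝓜.gc)
    {F : Frame P i 𝔸} (hXb : ∀ b, b ∈ F.X.bonds) (hXp : ∀ p, p ∈ F.X.plaqs) {c : StepConsts} (hξ : 0 < c.ξ) (hcB : 0 ≤ c.cB)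
    {α₀ α₁ γ₀ δ₀ δ₁ α₀' α₁' γ₀' : ℝ} (hα₀ : 0 ≤ α₀) (hα₁ : 0 ≤ α₁) (hδ₁ : 0 ≤ δ₁) (hs : c.ξ * (α₁ + 2 * δ₀) ≤ 1 / 16)
    (hα₀' : Real.exp (2 * (c.ξ * δ₀)) * α₀ ≤ α₀') (hγ₀' : Real.exp (2 * (c.ξ * δ₀)) * γ₀ ≤ γ₀')
    (hα₁' : (1 + 11 * c.ξ * (α₁ + 2 * δ₀)) *
        (α₁ + 2 * δ₀ + 2 * c.ξ * α₀ * δ₀ + 2 * ((1 + 4 * c.ξ * α₁) * δ₁ + 4 * α₁ * δ₀)) ≤ α₁')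
    {Φ : FieldPair P i 𝔸ˣ 𝔸} (h : SatisfiesI_III 𝓜 F c α₀ α₁ γ₀ Φ)
    {w : Site P i → 𝔸ˣ} (hw : ∀ x, w x ∈ 𝓜.G) {E : Site P i → 𝔸} (hEgc : ∀ x, E x ∈ 𝓜.gc)
    (heGc : ∀ x, expI c.ξ (E x) ∈ 𝓜.Gc) (hgcE : ∀ x, ∀ X ∈ 𝓜.gc, (expI c.ξ (E x) : 𝔸) * X * ↑(expI c.ξ (E x))⁻¹ ∈ 𝓜.gc)
    (hE0 : ∀ x, ‖E x‖ ≤ δ₀) (hE1 : ∀ x μ, ‖nabla c.ξ Φ.U μ E x‖ ≤ δ₁) :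
    SatisfiesI_III 𝓜 F c α₀' α₁' γ₀' (act (w * fun x => expI c.ξ (E x)) Φ) := by
  obtain ⟨hUGc, hJgc, U, A', hf, h1, h2, h3⟩ := h
  have hδ₀ : 0 ≤ δ₀ := (norm_nonneg _).trans (hE0 default)
  have hUG : ∀ b, U b ∈ 𝓜.G := fun b => h1.gValued b (hXb b)
  have hA : ∀ b, ‖A' b‖ ≤ α₁ := fun b => (h2.norm_lt b (hXb b)).le
  -- the covariant derivative of `E` in the `G`-valued factor
  set δ₁' := (1 + 4 * c.ξ * α₁) * δ₁ + 4 * α₁ * δ₀ with hδ₁'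
  have hδ₁'0 : 0 ≤ δ₁' := by positivity
  have hξα : c.ξ * α₁ ≤ 1 / 8 := by
    have : c.ξ * α₁ ≤ c.ξ * (α₁ + 2 * δ₀) := mul_le_mul_of_nonneg_left (by linarith) hξ.le
    linarith
  have hC : 0 ≤ 1 + 4 * c.ξ * α₁ := by positivity
  have hE1' : ∀ x μ, ‖nabla c.ξ U μ E x‖ ≤ δ₁' := fun x μ => by
    have h := norm_nabla_factor_le (E₁ := E (x.shift μ)) hξ hξα (hf ⟨x, μ⟩) (hA ⟨x, μ⟩) (hE0 x)
    have h' : ‖(c.ξ : ℂ)⁻¹ • ((Φ.U ⟨x, μ⟩ : 𝔸) * E (x.shift μ) * ↑(Φ.U ⟨x, μ⟩)⁻¹ - E x)‖ ≤ δ₁ := hE1 x μ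
    exact h.trans (by rw [hδ₁']; nlinarith [mul_le_mul_of_nonneg_left h' hC])
  have hα₀le : α₀ ≤ α₀' := by
    have : (1 : ℝ) * α₀ ≤ Real.exp (2 * (c.ξ * δ₀)) * α₀ :=
      mul_le_mul_of_nonneg_right (Real.one_le_exp (by positivity)) hα₀
    linarith
  refine ⟨?_, ?_, gaugeU w U,
    adJ w fun b => newPot c.ξ (E b.src) (newPot c.ξ (A' b) ((U b : 𝔸) * (-E b.tgt) * ↑(U b)⁻¹)), ?_, ?_, ?_, ?_⟩
  · -- `𝐔^v` is `Gᶜ`-valued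
    intro b _
    have hv : ∀ x, (w * fun x => expI c.ξ (E x)) x ∈ 𝓜.Gc := fun x => 𝓜.Gc.mul_mem (hGc (hw x)) (heGc x)
    exact 𝓜.Gc.mul_mem (𝓜.Gc.mul_mem (hv _) (hUGc b (hXb b))) (𝓜.Gc.inv_mem (hv _))
  · -- `R(v)𝐉` is `𝔤ᶜ`-valued
    intro b _
    have e : (act (w * fun x => expI c.ξ (E x)) Φ).J = adJ w (adJ (fun x => expI c.ξ (E x)) Φ.J) := adJ_mul _ _ _
    rw [e]
    exact hgc _ (hw _) _ (hgcE _ _ (hJgc b (hXb b)))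
  · exact factors_near hG1 hξ hα₁ hδ₀ hs hf hUG hA w hE0
  · exact condI_mono hcB hα₀le (condI_gaugeU hG1 hw h1)
  · exact condII_near hG1 hgc hgcN hXb hXp hξ hα₀ hα₁ hδ₀ hδ₁'0 hs hα₁' h1 h2 hw hEgc hE0 hE1'
  · exact condIII_near hG1 hξ.le hα₀ hα₀' hγ₀' hw hE0 h3

end

end Literature.MathematicalPhysics.QuantumFieldTheory.Balaban1983to89.B12Spaces329Near
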